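import Summits.BirchSwinnertonDyer.BirchSwinnertonDyer.Theorems.InertBadSignedBranchesInertBadAtThreeQuarticModelUnit
import HarnessLib

set_option linter.dupNamespace false -- `Summit.BirchSwinnertonDyer.BirchSwinnertonDyer.Theorems.…` (summit = sub, D-0017)
set_option autoImplicit false

/-!
# Crux `ManinDatumSupercuspidalCMInert` (stmt-BirchSwinnertonDyer-20111, BED r605), stub `stub_S7` — the MODEL LANE, prime-generic:
# the quartic cell `j = 1728` at an odd prime `p` is the integral family `y² = x³ + Ax`, `p ∣ A`, `A` fourth-power-free, with a
# `p`-ADIC UNIT scaling (width seat `bsd-wall-cm-bed-w2` g10; theorems only; `--supports 20111`, helper)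

Route `BiquadraticEisensteinDescent` (cell `pub/bsd-wall`, D-0152 M1). The registered stub `stub_S7` of crux R₅₇-supercuspidal (skeleton
`9438078f…`) concerns CM curves `W/ℚ` with `j(W) = 1728` additive at `p = 7`; it is CLOSED MODULO the named fact F″ (`…OfKato`, p596084)
and reduced by width seat bsd-wall-cm-bed-w4 g10's pointwise tame-twist lever to the plain `7`-integrality, in Néron units, of the odd
twisted modular-symbol sums of the newform of `W`. This file is the `p = 7`-usable twin of the `p = 3` model lane of crux
`InertBadAtThree` (w3 g8's `…QuarticModel` §3 / `…QuarticModelUnit`, w2 g8's `…QuarticModelFourthPowerFree`), written ONCE for a generic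
odd prime, so that value statements move from `W` to the explicit CM model `y² = x³ + Ax` with its own `a_n` and Néron-type periods
(`…QuarticModel.LValueOdd_of_smul` / `LValueEven_of_smul`, any prime `p ∤ den u_C`). Companion: `…CMInertCMModelsSextic` (`j = 0`, `p ≥ 5`).

* `padicValRat_u_eq_zero_of_smul_eq_quartic_of_ne_two` — `C • V = ⟨0,0,0,A,0⟩`, `A ∈ ℤ`, `p⁴ ∤ A`, `V` globally minimal ⇒ `v_p(u_C) = 0`
  (`12·v_p(u_C) + 3·v_p(A) = v_p(Δ(V)) ≤ v_p(Δ(model)) = 3·v_p(A) ≤ 9`, and `v_p(Δ(V)) ≥ 0`);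
* `exists_smul_eq_quartic_of_ne_two`, ★ `exists_smul_eq_quartic_fourthPowerFree_of_ne_two` — every globally minimal `V` with
  `j(V) = 1728` bad at `p` has `C • V = ⟨0,0,0,A,0⟩` with `A ≠ 0`, `p ∣ A`, `q⁴ ∤ A` for every prime `q`, and `v_p(u_C) = 0`;
* `one_le_padicValInt_quartic` — then `1 ≤ v_p(A) ≤ 3` (the Kodaira cells III / I₀* / III*). The coprimality `ℓ ∤ N_V ⇒ ℓ ∤ A`
  (`ℓ ≠ 2`) is w3 g8's prime-generic `…QuarticModelUnit.not_dvd_quartic_of_not_dvd_conductorNorm`.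

HONEST FRAMING: bookkeeping only (Silverman *AEC* X.5.4 (iii), VII.1 Remark 1.1, VII.5 Prop. 5.1 (a)); nothing here proves an `L`-value
integrality, the stub, the crux `ManinDatumSupercuspidalCMInert`, Manin's conjecture or BSD. No definition, no named fact, no `sorry`.
-/

noncomputable section

open scoped Classical NumberField

open WeierstrassCurve NumberField IsDedekindDomain Rat.HeightOneSpectrum
open Literature.NumberTheory.EllipticCurves
open Literature.NumberTheory.GaloisRepresentations
open Literature.NumberTheory.DiophantineGeometry
open Literature.NumberTheory.EllipticCurves.Rank1Residual
open Summit.BirchSwinnertonDyer.Rank1Residual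
open Summit.BirchSwinnertonDyer.Rank1Residual.X12

namespace Summit.BirchSwinnertonDyer.BirchSwinnertonDyer.Theorems.BiquadraticEisensteinDescentManinDatumSupercuspidalCMInertCMModelsQuartic

open Summit.BirchSwinnertonDyer.BirchSwinnertonDyer.Theorems.InertBadSignedBranchesInertBadAtThreeQuarticModel (Δ_quartic)
open Summit.BirchSwinnertonDyer.BirchSwinnertonDyer.Theorems.InertBadSignedBranchesInertBadAtThreeQuarticModelFourthPowerFree
  (exists_eq_pow_four_mul_fourthPowerFree)
open Summit.BirchSwinnertonDyer.BirchSwinnertonDyer.Theorems.InertBadOffQuarticFamilyIff (hasGoodReductionAt_of_eq_quartic_unit)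

/-! ## §0 Small arithmetic -/

/-- An odd prime does not divide `64`. [folklore] -/
theorem padicValNat_sixtyFour_eq_zero {p : ℕ} (hp : p.Prime) (hp2 : p ≠ 2) : padicValNat p 64 = 0 := by
  refine padicValNat.eq_zero_of_not_dvd fun h ↦ hp2 ?_
  have h' : p ∣ 2 ^ 6 := by simpa using h
  exact (Nat.prime_dvd_prime_iff_eq hp Nat.prime_two).mp (hp.dvd_of_dvd_pow h')

/-! ## §1 The quartic cell `j = 1728` at an odd prime -/

section Quartic

variable {p : ℕ} [hp : Fact p.Prime]

/-- ★ **The scaling to a `p`-fourth-power-free quartic model is a `p`-adic unit** (`p` odd). For a globally minimal elliptic `V/ℚ`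
and `C` with `C • V = ⟨0, 0, 0, A, 0⟩`, `A ∈ ℤ`, `p⁴ ∤ A`: `v_p(u_C) = 0`. (Verbatim the `p = 3` argument of w3 g8's
`…QuarticModelUnit.padicValRat_u_eq_zero_of_smul_eq_quartic`: the model is `p`-integral, so minimality of `V` at `p` bounds
`12·v_p(u_C) + 3·v_p(A) = v_p(Δ(V)) ≤ 3·v_p(A) ≤ 9`, and `v_p(Δ(V)) ≥ 0`.) [cite: SilvermanAEC2009, VII.1 Remark 1.1 and Prop. 1.3] -/
theorem padicValRat_u_eq_zero_of_smul_eq_quartic_of_ne_two (hp2 : p ≠ 2) (V : WeierstrassCurve ℚ) [V.IsElliptic]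
    [V.IsGloballyMinimal] {A : ℤ} {C : VariableChange ℚ} (hCV : C • V = ⟨0, 0, 0, (A : ℚ), 0⟩)
    (h4 : ¬ (p : ℤ) ^ 4 ∣ A) : padicValRat p (C.u : ℚ) = 0 := by
  have hpP : p.Prime := hp.out
  have hA0 : A ≠ 0 := by
    intro hA
    have hΔ : (C • V).Δ ≠ 0 := (C • V).isUnit_Δ.ne_zero
    rw [hCV, Δ_quartic, hA] at hΔ
    norm_num at hΔ
  -- the place `v = (p)` of `ℤ`
  set v : HeightOneSpectrum ℤ := (Rat.HeightOneSpectrum.primesEquiv (R := ℤ)).symm ⟨p, hpP⟩ with hvdef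
  have hv : Rat.HeightOneSpectrum.natGenerator v = p :=
    congrArg Subtype.val ((Rat.HeightOneSpectrum.primesEquiv (R := ℤ)).apply_symm_apply ⟨p, hpP⟩)
  -- the model is integral at `p`, so `v_p(Δ(V)) ≤ v_p(Δ(model))`
  have hint : (C • V).IsIntegralAt v := by
    rw [hCV, show (⟨0, 0, 0, (A : ℚ), 0⟩ : WeierstrassCurve ℚ) = (⟨0, 0, 0, A, 0⟩ : WeierstrassCurve ℤ).baseChange ℚ by
      ext <;> simp [WeierstrassCurve.baseChange, WeierstrassCurve.map]]
    exact isIntegralAt_baseChange_int v _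
  have hle := valuation_Δ_smul_le_of_isMinimalAt v (IsGloballyMinimal.isMinimalAt_int V v) C hint
  rw [hCV, Δ_quartic] at hle
  have hu0 : (C.u : ℚ) ≠ 0 := C.u.ne_zero
  have hA0' : (A : ℚ) ≠ 0 := by exact_mod_cast hA0
  have hΔV : V.Δ = (C.u : ℚ) ^ 12 * (-64 * (A : ℚ) ^ 3) := by
    have h := congrArg WeierstrassCurve.Δ hCV
    rw [variableChange_Δ, Δ_quartic, Units.val_inv_eq_inv_val] at h
    field_simp at h
    linear_combination h
  have hΔV0 : V.Δ ≠ 0 := by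
    rw [hΔV]; exact mul_ne_zero (pow_ne_zero _ hu0) (mul_ne_zero (by norm_num) (pow_ne_zero _ hA0'))
  have hΔA0 : (-64 * (A : ℚ) ^ 3) ≠ 0 := mul_ne_zero (by norm_num) (pow_ne_zero _ hA0')
  rw [Rat.HeightOneSpectrum.valuation_eq_exp_neg_padicValRat v hΔA0,
    Rat.HeightOneSpectrum.valuation_eq_exp_neg_padicValRat v hΔV0, hv, WithZero.exp_le_exp, neg_le_neg_iff] at hle
  -- valuations
  have h64 : padicValRat p (-64 : ℚ) = 0 := by
    rw [padicValRat.neg, show (64 : ℚ) = ((64 : ℕ) : ℚ) by norm_num, padicValRat.of_nat,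
      padicValNat_sixtyFour_eq_zero hpP hp2]
    simp
  have hvmod : padicValRat p (-64 * (A : ℚ) ^ 3) = 3 * padicValInt p A := by
    rw [padicValRat.mul (by norm_num) (pow_ne_zero _ hA0'), h64, padicValRat.pow (A : ℚ), padicValRat.of_int]; ring
  have hvV : padicValRat p V.Δ = 12 * padicValRat p (C.u : ℚ) + 3 * padicValInt p A := by
    rw [hΔV, padicValRat.mul (pow_ne_zero _ hu0) hΔA0, padicValRat.pow (C.u : ℚ), hvmod]; ring
  -- `v_p(Δ(V)) ≥ 0` (an integer) and `v_p(A) ≤ 3`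
  have hmin : (0 : ℤ) ≤ padicValRat p V.Δ := by
    rw [← cast_minimalDiscriminantInt V, padicValRat.of_int]; exact_mod_cast Nat.zero_le _
  have hk : padicValInt p A ≤ 3 := by
    by_contra h
    exact h4 (by exact_mod_cast (padicValInt_dvd_iff (p := p) 4 A).mpr (Or.inr (by omega)))
  rw [hvmod, hvV] at hle
  rw [hvV] at hmin
  have hk' : (padicValInt p A : ℤ) ≤ 3 := by exact_mod_cast hk
  have h1 : padicValRat p (C.u : ℚ) ≤ 0 := by linarith
  have h2 : -1 < padicValRat p (C.u : ℚ) := by linarith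
  omega

/-- **The quartic cell is the family `y² = x³ + Ax`, `p ∣ A`, `A` fourth-power-free** (`p` odd). A globally minimal `V/ℚ` with
`j(V) = 1728` bad at `p` is `ℚ`-isomorphic to `⟨0,0,0,A,0⟩` for a fourth-power-free `A ∈ ℤ ∖ 0` with `p ∣ A`. (w2 g8's
`…QuarticModelFourthPowerFree.stub_quarticModel` with `3 ↦ p`: *AEC* X.5.4 (iii) normal form `exists_variableChange_eq_of_j_eq_1728`,
the scalings `(m; 0,0,0)` to the fourth-power-free part, and good reduction of `y² = x³ + Ax` at `p ∤ A`, `p ≠ 2`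
(`hasGoodReductionAt_of_eq_quartic_unit`) transported along `ℚ`-isomorphisms.) [cite: SilvermanAEC2009, X.5.4 (iii) and VII.5 Prop. 5.1 (a)] -/
theorem exists_smul_eq_quartic_of_ne_two (hp2 : p ≠ 2) (V : WeierstrassCurve ℚ) [V.IsElliptic] [V.IsGloballyMinimal]
    (hj : V.j = 1728) (hbad : ¬ V.HasGoodReductionAtPrime p) :
    ∃ (A : ℤ) (C : WeierstrassCurve.VariableChange ℚ), C • V = ⟨0, 0, 0, (A : ℚ), 0⟩ ∧ A ≠ 0 ∧ (p : ℤ) ∣ A ∧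
      (∀ q : ℕ, q.Prime → ¬ ((q : ℤ) ^ 4 ∣ A)) := by
  have hpP : p.Prime := hp.out
  -- the normal form `C • V = (y² = x³ + A x)`, `A = 2^r A₀ ∈ ℤ ∖ {0}`
  obtain ⟨r, A₀, C, -, hodd, hC⟩ := exists_variableChange_eq_of_j_eq_1728 V hj
  have hA00 : A₀ ≠ 0 := by rintro rfl; exact absurd hodd (by decide)
  set A : ℤ := 2 ^ r * A₀ with hA
  have hA0 : A ≠ 0 := mul_ne_zero (pow_ne_zero _ two_ne_zero) hA00
  have hC' : C • V = ⟨0, 0, 0, (A : ℚ), 0⟩ := by rw [hC, hA]; push_cast; rfl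
  -- the fourth-power-free part `A = m⁴ B`, rescale by `u = m`
  obtain ⟨m, B, hm, hAB, hB⟩ := exists_eq_pow_four_mul_fourthPowerFree A hA0
  have hB0 : B ≠ 0 := by rintro rfl; rw [mul_zero] at hAB; exact hA0 hAB
  have hm0 : (m : ℚ) ≠ 0 := by exact_mod_cast hm.ne'
  set u : ℚˣ := Units.mk0 (m : ℚ) hm0 with hu
  have hu4 : ((u : ℚ))⁻¹ ^ 4 * ((m : ℚ)) ^ 4 = 1 := by
    rw [← mul_pow, hu, Units.val_mk0, inv_mul_cancel₀ hm0, one_pow]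
  set e : VariableChange ℚ := ⟨u, 0, 0, 0⟩ * C with he
  have hD : e • V = ⟨0, 0, 0, (B : ℚ), 0⟩ := by
    rw [he, mul_smul, hC', X12.smul_quartic_scale, hAB]
    push_cast
    rw [← mul_assoc, hu4, one_mul]
  haveI : (e • V).IsElliptic := inferInstance
  -- `p ∣ B`: otherwise good reduction at `p`
  have hpB : (p : ℤ) ∣ B := by
    by_contra hpB
    set v : HeightOneSpectrum (𝓞 ℚ) := (primesEquiv (R := 𝓞 ℚ)).symm ⟨p, hpP⟩ with hvdef
    have hpv : primesEquiv v = ⟨p, hpP⟩ := (primesEquiv (R := 𝓞 ℚ)).apply_symm_apply ⟨p, hpP⟩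
    have hv : natGenerator v = p := congrArg Subtype.val hpv
    have hv2 : natGenerator v ≠ 2 := by rw [hv]; exact hp2
    have hval : v.valuation ℚ ((B : ℤ) : ℚ) = 1 :=
      Rat.valuation_intCast_eq_one v (by rw [hv]; exact_mod_cast hpB)
    have hgood := hasGoodReductionAt_of_eq_quartic_unit (e • V) v hv2 hD hval
    exact hbad ((good_iff_hasGoodReductionAt V p v hv).mpr ((hasGoodReductionAt_smul_iff_holds v V e).mp hgood))
  exact ⟨B, e, hD, hB0, hpB, hB⟩

/-- ★ **The fourth-power-free quartic model with `p`-adic unit scaling** (`p` odd). Every globally minimal elliptic `V/ℚ` with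
`j(V) = 1728` bad at `p` has `C • V = ⟨0, 0, 0, A, 0⟩` with `A ∈ ℤ ∖ 0`, `p ∣ A`, `q⁴ ∤ A` for every prime `q`, and `v_p(u_C) = 0` — so
`…QuarticModel.LValueOdd_of_smul` / `LValueEven_of_smul` move the `f`-free value statements between `V` and its model at `p`.
(The `p ∈ {5, 7}`-usable twin of w3 g8's `exists_smul_eq_quartic_fourthPowerFree`.) [cite: SilvermanAEC2009, X.5.4 (iii) and VII.1 Remark 1.1] -/
theorem exists_smul_eq_quartic_fourthPowerFree_of_ne_two (hp2 : p ≠ 2) (V : WeierstrassCurve ℚ) [V.IsElliptic]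
    [V.IsGloballyMinimal] (hj : V.j = 1728) (hbad : ¬ V.HasGoodReductionAtPrime p) :
    ∃ (A : ℤ) (C : VariableChange ℚ), C • V = ⟨0, 0, 0, (A : ℚ), 0⟩ ∧ A ≠ 0 ∧ (p : ℤ) ∣ A ∧
      (∀ q : ℕ, q.Prime → ¬ ((q : ℤ) ^ 4 ∣ A)) ∧ padicValRat p (C.u : ℚ) = 0 := by
  obtain ⟨A, C, hCV, hA0, hpA, h4⟩ := exists_smul_eq_quartic_of_ne_two hp2 V hj hbad
  exact ⟨A, C, hCV, hA0, hpA, h4, padicValRat_u_eq_zero_of_smul_eq_quartic_of_ne_two hp2 V hCV (h4 p hp.out)⟩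

omit hp in
/-- **The three cells**: for `A ≠ 0` with `p ∣ A` and `p⁴ ∤ A`, `1 ≤ v_p(A) ≤ 3` (Kodaira III / I₀* / III* for `y² = x³ + Ax`, `p` odd).
[cite: SilvermanATAEC1994, IV.9.4 and Table 4.1] -/
theorem one_le_padicValInt_quartic [Fact p.Prime] {A : ℤ} (hA0 : A ≠ 0) (hpA : (p : ℤ) ∣ A) (h4 : ¬ (p : ℤ) ^ 4 ∣ A) :
    1 ≤ padicValInt p A ∧ padicValInt p A ≤ 3 := by
  constructor
  · rcases (padicValInt_dvd_iff (p := p) 1 A).mp (by simpa using hpA) with h | h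
    · exact absurd h hA0
    · exact h
  · by_contra h
    exact h4 ((padicValInt_dvd_iff (p := p) 4 A).mpr (Or.inr (by omega)))

end Quartic

end Summit.BirchSwinnertonDyer.BirchSwinnertonDyer.Theorems.BiquadraticEisensteinDescentManinDatumSupercuspidalCMInertCMModelsQuartic

end
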